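import Summits.BirchSwinnertonDyer.Rank1Residual.X2.GreenbergVatsalReductionDatum
import Literature.NumberTheory.EllipticCurves.PAdicLFunctionProofs
import Literature.NumberTheory.EllipticCurves.OrdinaryPrimesProofs
import Literature.NumberTheory.EllipticCurves.KodairaNeronUnramifiedInertiaProofs
import Literature.NumberTheory.EllipticCurves.HasseWeilGoodReductionFrobenius
import Literature.NumberTheory.EllipticCurves.LFunctionPrimeCoeff
import Literature.NumberTheory.EllipticCurves.HasseManinFunctionField
import Literature.NumberTheory.EllipticCurves.MinimalModelReduction
import Literature.NumberTheory.GaloisRepresentations.InertiaRootsOfUnity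
import Literature.NumberTheory.Automorphic.AdicCompletionResidueCard
import HarnessLib

/-!
# The unit root of `X² − a_p X + p` modulo `p^k`, and the local Frobenius vocabulary at `v ∋ p`
# (route `SchneiderFreeAdditiveX3`, seat `bsd-schneider-door-c6` gen 3; helper toward the
# «canonical line WITH ITS CHARACTER» of crux r5 `LocalTowerTorsionFiniteX3`,
# stmt-BirchSwinnertonDyer-19546 — FILE 1 of the (G-ord, `e = 2`) plan, part a)

Elementary preliminaries of the unit-root Frobenius character of Greenberg's ordinary line
(Greenberg, LNM 1716, §2 p. 70: on the kernel of reduction `ℱ[p^∞]` the decomposition group acts by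
`φψ⁻¹`, `ψ` the UNRAMIFIED character with `ψ(Frob) = α`, `α` the unit root of `X² − a_p X + p`), in
the tree's vocabulary (`Literature.NumberTheory.EllipticCurves.unitRoot`, `IsFrobPow`, `specVal`):

* §1 `toZModPow_intCast_eq_unitRoot` — every integer `u` prime to `p` with
  `u² − a_p u + p ≡ 0 (mod p^k)` is `≡ α (mod p^k)` (`α = unitRoot W p`; the other root `a_p − α`
  has norm `< 1`, so `u − (a_p − α)` is a unit and `p^k ∣ (u − α)(u − a_p + α)`);
* §2 `specVal_smul_sub_pow_lt_one_of_isFrobPow` — an element of `Γ_{ℚ_v}` of Frobenius degree `n`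
  (`IsFrobPow σ n`, Tate's normalisation) satisfies `|σ z − z^{p^n}|_v < 1` on the valuation ring of
  the spectral valuation `specVal v` of `\bar ℚ_v` (both unit balls agree,
  `spectralValuation_le_one_iff_algNorm_le_one`, and `#k(ℚ_v) = p`);
* §3 `tr_integralModelInt_baseChange_eq_frobeniusTrace` — Manin's trace `q + 1 − #W₁(k_v)` of the
  reduction `W₁ = W_ℤ ⊗ k_v` of the minimal model over the residue field `k_v` of `ℚ_v` is the
  tree's `a_p = W.frobeniusTrace p` (`k_v ≃ ℤ/p`).

Proofs only (no definition, no named fact, no `sorry`); closes nothing by itself; BSD is not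
advanced.  References: [GreenbergLNM1716] §2 p. 70; [MazurTateTeitelbaum1986Invent] §I.11;
[SilvermanAEC2009] V.2.3.1, VII.2.1; [TateCorvallis1979] (1.4.1).
-/

noncomputable section

open scoped Classical NNReal

open NumberField IsDedekindDomain Field ValuativeRel
open Literature.NumberTheory.EllipticCurves Literature.NumberTheory.GaloisRepresentations
  Literature.NumberTheory.GaloisRepresentations.IsNonarchimedeanLocalField
  IsDedekindDomain.HeightOneSpectrum
  Summit.BirchSwinnertonDyer.Rank1Residual.X2.GreenbergVatsalReductionDatum
open WeierstrassCurve (minimalDiscriminantInt integralModelInt)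

namespace Summit.BirchSwinnertonDyer.BirchSwinnertonDyer.Theorems.SchneiderFreeAdditiveX3

set_option linter.dupNamespace false

variable (W : WeierstrassCurve ℚ) [W.IsGloballyMinimal] (p : ℕ) [hp : Fact p.Prime]
  {v : HeightOneSpectrum (𝓞 ℚ)}

/-! ## §1. The unit root modulo `p^k` -/

/-- **The unit root modulo `p^k`.** At a good ordinary prime (`p ∤ Δ_E`, `p ∤ a_p`), every integer
`u` prime to `p` with `u² − a_p u + p ≡ 0 (mod p^k)` satisfies `u ≡ α (mod p^k)` for the unit root
`α = unitRoot W p` of `X² − a_p X + p` (`unitRoot_spec_holds`): the other root `α' = a_p − α = p/α`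
has norm `< 1`, so `u − α'` is a unit and `|u − α| = |(u − α)(u − α')| = |u² − a_p u + p| ≤ p^{-k}`.
[cite: MazurTateTeitelbaum1986Invent, §I.11] -/
theorem toZModPow_intCast_eq_unitRoot (hΔ : ¬ (p : ℤ) ∣ minimalDiscriminantInt W)
    (hord : ¬ (p : ℤ) ∣ W.frobeniusTrace p) (k : ℕ) (u : ℤ)
    (hdvd : ((p : ℤ) ^ k) ∣ u ^ 2 - W.frobeniusTrace p * u + p) (hpu : ¬ (p : ℤ) ∣ u) :
    PadicInt.toZModPow k (u : ℤ_[p]) = PadicInt.toZModPow k (unitRoot W p) := by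
  obtain ⟨hz, hzu⟩ := unitRoot_spec_holds W p ⟨W.hasGoodReductionAtPrime_of_not_dvd p hΔ, hord⟩
  set a : ℤ := W.frobeniusTrace p with ha
  set z : ℤ_[p] := unitRoot W p with hzdef
  have hz1 : ‖z‖ = 1 := PadicInt.isUnit_iff.mp hzu
  have hp1 : ‖(p : ℤ_[p])‖ < 1 := (PadicInt.norm_lt_one_iff_dvd _).mpr (dvd_refl _)
  -- the other root `z' = a − z` has `z z' = p`, `‖z'‖ < 1`
  set z' : ℤ_[p] := a - z with hz'
  have hzz' : z * z' = p := by rw [hz']; linear_combination -hz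
  have hz'1 : ‖z'‖ < 1 := by
    have h1 : ‖z‖ * ‖z'‖ = ‖(p : ℤ_[p])‖ := by rw [← norm_mul, hzz']
    rw [hz1, one_mul] at h1
    rw [h1]; exact hp1
  have hu1 : ‖(u : ℤ_[p])‖ = 1 := by
    refine le_antisymm (PadicInt.norm_le_one _) (not_lt.mp fun hlt ↦ hpu ?_)
    exact (PadicInt.norm_int_lt_one_iff_dvd u).mp hlt
  have huz' : ‖(u : ℤ_[p]) - z'‖ = 1 := by
    have hne' : ‖(u : ℤ_[p])‖ ≠ ‖z'‖ := by rw [hu1]; exact (ne_of_lt hz'1).symm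
    rw [sub_eq_add_neg, IsUltrametricDist.norm_add_eq_max_of_norm_ne_norm (by rwa [norm_neg]),
      norm_neg, hu1, max_eq_left (le_of_lt hz'1)]
  -- `(u − z)(u − z') = u² − au + p`, of norm `≤ p^{-k}`
  have hprod : ((u : ℤ_[p]) - z) * ((u : ℤ_[p]) - z') = u ^ 2 - a * u + p := by
    rw [hz']; linear_combination (-1 : ℤ_[p]) * hz
  have hN : ‖((u ^ 2 - a * u + p : ℤ) : ℤ_[p])‖ ≤ (p : ℝ) ^ (-(k : ℤ)) := by
    rw [PadicInt.norm_le_pow_iff_mem_span_pow, Ideal.mem_span_singleton]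
    obtain ⟨c, hc⟩ := hdvd
    exact ⟨(c : ℤ_[p]), by rw [hc]; push_cast; ring⟩
  have hN' : ‖(u : ℤ_[p]) - z‖ ≤ (p : ℝ) ^ (-(k : ℤ)) := by
    have h1 : ‖(u : ℤ_[p]) - z‖ = ‖((u : ℤ_[p]) - z) * ((u : ℤ_[p]) - z')‖ := by
      rw [norm_mul, huz', mul_one]
    rw [h1, hprod]
    push_cast at hN ⊢
    exact hN
  rw [PadicInt.norm_le_pow_iff_mem_span_pow, ← PadicInt.ker_toZModPow, RingHom.mem_ker,
    map_sub, sub_eq_zero] at hN'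
  exact hN'

/-- The unit root is prime to `p` at every level: `α^n mod p^k`, read as a natural number, and its
companions `χ · α^{-n}` are units — here in the form consumed below: `(toZModPow k x).val`, cast
back, has the same image as `x`. [folklore] -/
theorem toZModPow_natCast_val (k : ℕ) (x : ℤ_[p]) :
    PadicInt.toZModPow k (((PadicInt.toZModPow k x).val : ℕ) : ℤ_[p]) = PadicInt.toZModPow k x := by
  rw [map_natCast, ZMod.natCast_zmod_val]

/-! ## §2. Frobenius degree `n` in the spectral valuation -/

/-- **`IsFrobPow σ n` in the spectral valuation of `\bar ℚ_v`.** For the place `v ∋ p` of `ℚ` and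
`σ ∈ Γ_{ℚ_v}` of Frobenius degree `n` (`IsFrobPow σ n`: `σ x ≡ x^{q^n}` modulo the maximal ideal of
the absolute integers of the `ValuativeRel` structure, `q = #k(ℚ_v) = p`), every `z ∈ \bar ℚ_v` with
`|z|_v ≤ 1` satisfies `|σ z − z^{p^n}|_v < 1` for the spectral valuation `specVal v` (the two closed
and open unit balls coincide: `spectralValuation_le_one_iff_algNorm_le_one`,
`mem_absMaximalIdeal_iff_algNorm_lt_one`). [cite: TateCorvallis1979, §1.4 (1.4.1)] -/
theorem specVal_smul_sub_pow_lt_one_of_isFrobPow (hpv : ((p : ℕ) : 𝓞 ℚ) ∈ v.asIdeal)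
    {σ : absoluteGaloisGroup (v.adicCompletion ℚ)} {n : ℕ} (hσ : IsFrobPow σ (n : ℤ))
    (z : AlgebraicClosure (v.adicCompletion ℚ)) (hz : specVal v z ≤ 1) :
    specVal v (σ • z - z ^ p ^ n) < 1 := by
  have hw := specVal_spec v
  have hq : residueFieldCard (v.adicCompletion ℚ) = p := by
    rw [Literature.NumberTheory.Automorphic.residueFieldCard_adicCompletion_eq,
      ← WeierstrassCurve.natCard_residueField_eq_residueCard,
      WeierstrassCurve.natCard_residueField_adicCompletionIntegers v,
      Rat.HeightOneSpectrum.primesEquiv_eq_of_natCast_mem v hp.out hpv]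
  have hzmem : z ∈ absIntegers 𝒪[v.adicCompletion ℚ] (v.adicCompletion ℚ) :=
    mem_absIntegers_iff_algNorm_le_one.2 ((spectralValuation_le_one_iff_algNorm_le_one hw _).1 hz)
  have h := (isFrobPow_natCast_iff (n := n)).1 hσ ⟨_, hzmem⟩
  rw [hq] at h
  have hlt := mem_absMaximalIdeal_iff_algNorm_lt_one.1 h
  exact (spectralValuation_lt_one_iff_algNorm_lt_one hw _).2 hlt

/-! ## §3. Manin's trace of the reduction over `k_v` is `a_p` -/

/-- **`tr(W_ℤ ⊗ k_v) = a_p`.** For the place `v ∋ p` of `ℚ`, the trace `#k_v + 1 − #W₁(k_v)` of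
the reduction `W₁ = W_ℤ ⊗ k_v` of the minimal model over the residue field `k_v` of `ℚ_v` (any
`Fintype` structure) is `W.frobeniusTrace p = p + 1 − #W_ℤ(ℤ/p)` (`k_v ≃ ℤ/p`, and mapping a
Weierstrass equation along a ring isomorphism does not change the number of points).
[cite: SilvermanAEC2009, V.§2 Remark 2.6] -/
theorem tr_integralModelInt_baseChange_eq_frobeniusTrace
    [Fintype (IsLocalRing.ResidueField (v.adicCompletionIntegers ℚ))]
    (hpv : ((p : ℕ) : 𝓞 ℚ) ∈ v.asIdeal) :
    HasseManin.tr ((integralModelInt W).baseChange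
      (IsLocalRing.ResidueField (v.adicCompletionIntegers ℚ))) = W.frobeniusTrace p := by
  have hvp : (Rat.HeightOneSpectrum.primesEquiv v : ℕ) = p :=
    Rat.HeightOneSpectrum.primesEquiv_eq_of_natCast_mem v hp.out hpv
  have hqF : Fintype.card (IsLocalRing.ResidueField (v.adicCompletionIntegers ℚ)) = p := by
    rw [← Nat.card_eq_fintype_card, WeierstrassCurve.natCard_residueField_adicCompletionIntegers v,
      hvp]
  -- `k_v ≃ ℤ/p`
  set ψ : ZMod p ≃+* IsLocalRing.ResidueField (v.adicCompletionIntegers ℚ) :=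
    ZMod.ringEquivOfPrime _ hp.out hqF with hψ
  have hW : (integralModelInt W).baseChange (IsLocalRing.ResidueField (v.adicCompletionIntegers ℚ)) =
      ((integralModelInt W).map (Int.castRingHom (ZMod p))).map
        (ψ : ZMod p →+* IsLocalRing.ResidueField (v.adicCompletionIntegers ℚ)) := by
    rw [WeierstrassCurve.baseChange, WeierstrassCurve.map_map]
    exact congrArg _ (RingHom.ext_int _ _)
  rw [HasseManin.tr, hqF, hW, WeierstrassCurve.natCard_point_map_ringEquiv,
    WeierstrassCurve.frobeniusTrace, WeierstrassCurve.reductionPointCount]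

end Summit.BirchSwinnertonDyer.BirchSwinnertonDyer.Theorems.SchneiderFreeAdditiveX3

end
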